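import Mathlib
import HarnessLib

/-!
# `RationalShortRootRigidity` — negative lemma: FALSE without the `W(F₄)` reflection (axis RP + `W(B₄)` never
# forces `O(4)`)

Sharpness certificate for crux `stmt-QuantumFields-23124`
(`Summit.QuantumFields.YangMills.Theses.F4SubCurvatureDoor.RationalShortRootRigidity`, LINE g15-A of planner
ym-idea-3, critic idea-crit-4 g5 PASS; critic's remaining ask N1: land the `W(B₄)` witness under
`Theorems/…/Negative/` so that `ledger negatives` indexes it).  The crux says: `N, D ∈ ℝ[p₀,…,p₃]` invariant under
signed permutations (h1) AND under the short-root reflection `p ↦ p − ½(Σpᵢ)(1,1,1,1)` (h2), `D` of full degree in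
`p₀` (h3), `deg N ≤ deg D + 2` (h4), `N/D` axis-Stieltjes in `u = p₀²` for every spatial momentum `q ≠ 0` (h5)
`⟹ N/D` is a function of `p²` alone.  Here we prove that the SAME statement with h2 DELETED is false:

* witness `N = Σpᵢ² + 3/2`, `D = 2(Σpᵢ²)² − Σpᵢ⁴ + 3Σpᵢ² + 2` (functions of the `W(B₄)` power sums, so h1 holds);
* `deg D = 4` with `coeff_{p₀⁴} D = 1` (h3), `deg N ≤ 2` (h4);
* for EVERY `q ∈ ℝ³` (not only `q ≠ 0`): with `r = |q|²`, `s₄ = Σqᵢ⁴`, `b = 4r+3`, `c = 2r²−s₄+3r+2`, the denominator is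
  `u² + bu + c = (u + a₋)(u + a₊)`, `a∓ = (b ∓ √(b²−4c))/2`, `b² − 4c ≥ 1`, `0 < a₋ < a₊`, and the numerator's zero
  `u = −r−3/2` lies strictly between the shells (`D(−r−3/2) = −r²−3r−¼−s₄ < 0`), so
  `N/D = r₋/(u+a₋) + r₊/(u+a₊)` with `r∓ ≥ 0` (h5 with `k = 2`, `c = 0`);
* NOT radial: the axis point `(2t,0,0,0)` and the diagonal point `(t,t,t,t)` have the same `Σpᵢ² = 4t²` but
  `D = 16t⁴+12t²+2` resp. `28t⁴+12t²+2`, so `N·G(p²) = D·F(p²)` forces `12t⁴·F(4t²) = 0`, `F = 0`, then `G = 0`.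

So the half-integer short roots (the extra `W(F₄)` mirror at 60°) are exactly what the rigidity needs; cf. the
planner's dossier HOME l15/RATIONAL-SHORT-ROOT-RIGIDITY.md (Prop. B) and l15/B4AxisRPCounterexample.lean, whose
real-number certificates are re-proved here in place.  Mathlib only; no summit, rung or crux is proved or refuted by
this file (the crux itself keeps h2 and is untouched).

Free-hands width seat `ym-line-sfw-p2-w4` (cell ym-idea-1).
-/

set_option autoImplicit false

namespace Summit.QuantumFields.YangMills.Theorems.RationalShortRootRigidity.Negative

open MvPolynomial Finset
open scoped BigOperators Polynomial

/-! ## The witness: evaluations and `W(B₄)`-invariance -/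

/-- Evaluation of the witness numerator `N = Σ Xᵢ² + 3/2`. [folklore] -/
theorem eval_witnessN (p : Fin 4 → ℝ) :
    MvPolynomial.eval p ((∑ i : Fin 4, X i ^ 2) + C (3 / 2 : ℝ) : MvPolynomial (Fin 4) ℝ) =
      (∑ i, p i ^ 2) + 3 / 2 := by
  simp only [map_add, map_sum, map_pow, eval_X, eval_C]

/-- Evaluation of the witness denominator `D = 2(Σ Xᵢ²)² − Σ Xᵢ⁴ + 3 Σ Xᵢ² + 2`. [folklore] -/
theorem eval_witnessD (p : Fin 4 → ℝ) :
    MvPolynomial.eval p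
        (C (2 : ℝ) * (∑ i : Fin 4, X i ^ 2) ^ 2 - (∑ i : Fin 4, X i ^ 4) + C (3 : ℝ) * (∑ i : Fin 4, X i ^ 2) +
          C (2 : ℝ) : MvPolynomial (Fin 4) ℝ) =
      2 * (∑ i, p i ^ 2) ^ 2 - (∑ i, p i ^ 4) + 3 * (∑ i, p i ^ 2) + 2 := by
  simp only [map_add, map_sub, map_mul, map_sum, map_pow, eval_X, eval_C]

/-- Signed permutations preserve every even power sum. [folklore] -/
theorem sum_pow_signedPerm (σ : Equiv.Perm (Fin 4)) (ε : Fin 4 → ℝ) (hε : ∀ i, ε i = 1 ∨ ε i = -1)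
    (p : Fin 4 → ℝ) (n : ℕ) :
    (∑ i, (ε i * p (σ i)) ^ (2 * n)) = ∑ i, p i ^ (2 * n) := by
  have h : ∀ i, (ε i * p (σ i)) ^ (2 * n) = p (σ i) ^ (2 * n) := by
    intro i
    rw [mul_pow, pow_mul, pow_mul]
    rcases hε i with h | h <;> simp [h]
  simp only [h]
  exact Equiv.sum_comp σ (fun i => p i ^ (2 * n))

/-! ## Degrees: `deg N ≤ 2`, `deg D = 4`, `coeff_{X₀⁴} D = 1` -/

/-- `deg (Σ Xᵢ^n) ≤ n`. [folklore] -/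
theorem totalDegree_sum_X_pow_le (n : ℕ) :
    ((∑ i : Fin 4, X i ^ n : MvPolynomial (Fin 4) ℝ)).totalDegree ≤ n := by
  refine (totalDegree_finsetSum _ _).trans (Finset.sup_le fun i _ => ?_)
  refine (totalDegree_pow _ _).trans ?_
  rw [totalDegree_X]
  simp

/-- `deg N ≤ 2`. [folklore] -/
theorem totalDegree_witnessN_le :
    ((∑ i : Fin 4, X i ^ 2) + C (3 / 2 : ℝ) : MvPolynomial (Fin 4) ℝ).totalDegree ≤ 2 := by
  refine (totalDegree_add _ _).trans (max_le (totalDegree_sum_X_pow_le 2) ?_)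
  rw [totalDegree_C]
  exact Nat.zero_le _

/-- `deg D ≤ 4`. [folklore] -/
theorem totalDegree_witnessD_le :
    (C (2 : ℝ) * (∑ i : Fin 4, X i ^ 2) ^ 2 - (∑ i : Fin 4, X i ^ 4) + C (3 : ℝ) * (∑ i : Fin 4, X i ^ 2) +
          C (2 : ℝ) : MvPolynomial (Fin 4) ℝ).totalDegree ≤ 4 := by
  have h2 := totalDegree_sum_X_pow_le 2
  have h4 := totalDegree_sum_X_pow_le 4
  refine (totalDegree_add _ _).trans (max_le ?_ (by rw [totalDegree_C]; exact Nat.zero_le _))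
  refine (totalDegree_add _ _).trans (max_le ?_ ?_)
  · refine (totalDegree_sub _ _).trans (max_le ?_ h4)
    refine (totalDegree_mul _ _).trans ?_
    rw [totalDegree_C, zero_add]
    exact (totalDegree_pow _ _).trans (by omega)
  · refine (totalDegree_mul _ _).trans ?_
    rw [totalDegree_C, zero_add]
    exact h2.trans (by norm_num)

/-- `eᵢ·2 + eⱼ·2 = e₀·4` in `ℕ^4` iff `i = j = 0`. [folklore] -/
theorem single_two_add_single_two_eq (i j : Fin 4) :
    Finsupp.single i 2 + Finsupp.single j 2 = Finsupp.single (0 : Fin 4) 4 ↔ i = 0 ∧ j = 0 := by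
  constructor
  · intro h
    have h0 := DFunLike.congr_fun h 0
    simp only [Finsupp.coe_add, Pi.add_apply, Finsupp.single_apply] at h0
    by_cases hi : i = 0 <;> by_cases hj : j = 0 <;> simp_all
  · rintro ⟨rfl, rfl⟩
    rw [← Finsupp.single_add]

/-- `coeff_{X₀⁴} (Σ Xᵢ²)² = 1`. [folklore] -/
theorem coeff_sum_sq_sq :
    MvPolynomial.coeff (Finsupp.single (0 : Fin 4) 4) ((∑ i : Fin 4, X i ^ 2 : MvPolynomial (Fin 4) ℝ) ^ 2) = 1 := by
  have hmon : ∀ i j : Fin 4, (X i ^ 2 * X j ^ 2 : MvPolynomial (Fin 4) ℝ) =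
      monomial (Finsupp.single i 2 + Finsupp.single j 2) 1 := by
    intro i j
    rw [X_pow_eq_monomial, X_pow_eq_monomial, monomial_mul, one_mul]
  rw [sq, Finset.sum_mul_sum]
  simp only [hmon, coeff_sum, coeff_monomial, single_two_add_single_two_eq]
  rw [Finset.sum_eq_single (0 : Fin 4)]
  · rw [Finset.sum_eq_single (0 : Fin 4)]
    · simp
    · intro j _ hj
      rw [if_neg (fun h => hj h.2)]
    · intro h; exact absurd (Finset.mem_univ _) h
  · intro i _ hi
    exact Finset.sum_eq_zero fun j _ => if_neg (fun h => hi h.1)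
  · intro h; exact absurd (Finset.mem_univ _) h

/-- `coeff_{X₀⁴} (Σ Xᵢ⁴) = 1`. [folklore] -/
theorem coeff_sum_X_pow_four :
    MvPolynomial.coeff (Finsupp.single (0 : Fin 4) 4) (∑ i : Fin 4, X i ^ 4 : MvPolynomial (Fin 4) ℝ) = 1 := by
  simp only [coeff_sum, coeff_X_pow]
  rw [Finset.sum_eq_single (0 : Fin 4)]
  · rw [if_pos rfl]
  · intro i _ hi
    rw [if_neg]
    intro h
    exact hi ((Finsupp.single_left_inj (show (4 : ℕ) ≠ 0 by norm_num)).mp h)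
  · intro h; exact absurd (Finset.mem_univ _) h

/-- `coeff_{X₀⁴} (Σ Xᵢ²) = 0`. [folklore] -/
theorem coeff_sum_X_sq :
    MvPolynomial.coeff (Finsupp.single (0 : Fin 4) 4) (∑ i : Fin 4, X i ^ 2 : MvPolynomial (Fin 4) ℝ) = 0 := by
  simp only [coeff_sum, coeff_X_pow]
  refine Finset.sum_eq_zero fun i _ => if_neg fun h => ?_
  have := DFunLike.congr_fun h i
  by_cases h0 : (0 : Fin 4) = i
  · subst h0
    rw [Finsupp.single_eq_same, Finsupp.single_eq_same] at this
    omega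
  · rw [Finsupp.single_eq_same, Finsupp.single_apply, if_neg h0] at this
    omega

/-- `coeff_{X₀⁴} D = 1`. [folklore] -/
theorem coeff_witnessD :
    MvPolynomial.coeff (Finsupp.single (0 : Fin 4) 4)
        (C (2 : ℝ) * (∑ i : Fin 4, X i ^ 2) ^ 2 - (∑ i : Fin 4, X i ^ 4) + C (3 : ℝ) * (∑ i : Fin 4, X i ^ 2) +
          C (2 : ℝ) : MvPolynomial (Fin 4) ℝ) = 1 := by
  have h0 : (0 : Fin 4 →₀ ℕ) ≠ Finsupp.single (0 : Fin 4) 4 := by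
    intro h
    have := DFunLike.congr_fun h 0
    simp at this
  rw [coeff_add, coeff_add, coeff_sub, coeff_C_mul, coeff_C_mul, coeff_sum_sq_sq, coeff_sum_X_pow_four,
    coeff_sum_X_sq, coeff_C, if_neg h0]
  norm_num

/-- `deg D = 4`. [folklore] -/
theorem totalDegree_witnessD :
    (C (2 : ℝ) * (∑ i : Fin 4, X i ^ 2) ^ 2 - (∑ i : Fin 4, X i ^ 4) + C (3 : ℝ) * (∑ i : Fin 4, X i ^ 2) +
          C (2 : ℝ) : MvPolynomial (Fin 4) ℝ).totalDegree = 4 := by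
  refine le_antisymm totalDegree_witnessD_le ?_
  have hmem : Finsupp.single (0 : Fin 4) 4 ∈
      (C (2 : ℝ) * (∑ i : Fin 4, X i ^ 2) ^ 2 - (∑ i : Fin 4, X i ^ 4) + C (3 : ℝ) * (∑ i : Fin 4, X i ^ 2) +
          C (2 : ℝ) : MvPolynomial (Fin 4) ℝ).support := by
    rw [mem_support_iff, coeff_witnessD]
    exact one_ne_zero
  have := le_totalDegree hmem
  simpa using this

/-! ## Axis reflection positivity: two positive shells with non-negative residues, for every `q` -/

/-- `Σ qᵢ⁴ ≤ (Σ qᵢ²)²` on `ℝ³`. [folklore] -/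
theorem sum_pow_four_le_sq (q : Fin 3 → ℝ) : (∑ i, q i ^ 4) ≤ (∑ i, q i ^ 2) ^ 2 := by
  simp only [Fin.sum_univ_three]
  nlinarith [mul_nonneg (sq_nonneg (q 0)) (sq_nonneg (q 1)), mul_nonneg (sq_nonneg (q 0)) (sq_nonneg (q 2)),
    mul_nonneg (sq_nonneg (q 1)) (sq_nonneg (q 2))]

/-- The axis-Stieltjes decomposition of the witness for EVERY spatial momentum `q`:
`N(t,q)/D(t,q) = r₋/(t² + a₋) + r₊/(t² + a₊)` with `0 < a₋ < a₊`, `r∓ ≥ 0` (`k = 2`, polynomial part `0`).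
[folklore] -/
theorem witness_axisStieltjes (q : Fin 3 → ℝ) :
    ∃ (k : ℕ) (ω r : Fin k → ℝ) (c : Polynomial ℝ), (∀ j, 0 < ω j) ∧ (∀ j, 0 ≤ r j) ∧ ∀ t : ℝ,
      MvPolynomial.eval (Fin.cons t q) ((∑ i : Fin 4, X i ^ 2) + C (3 / 2 : ℝ) : MvPolynomial (Fin 4) ℝ) =
        MvPolynomial.eval (Fin.cons t q)
            (C (2 : ℝ) * (∑ i : Fin 4, X i ^ 2) ^ 2 - (∑ i : Fin 4, X i ^ 4) + C (3 : ℝ) * (∑ i : Fin 4, X i ^ 2) +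
              C (2 : ℝ) : MvPolynomial (Fin 4) ℝ) *
          (c.eval (t ^ 2) + ∑ j, r j / (t ^ 2 + ω j ^ 2)) := by
  -- spatial data
  set rr : ℝ := ∑ i, q i ^ 2 with hrr
  set s4 : ℝ := ∑ i, q i ^ 4 with hs4
  have hrr0 : 0 ≤ rr := Finset.sum_nonneg fun i _ => by positivity
  have hs40 : 0 ≤ s4 := Finset.sum_nonneg fun i _ => by positivity
  have hs4le : s4 ≤ rr ^ 2 := sum_pow_four_le_sq q
  -- the quadratic in `u = t²`
  set b : ℝ := 4 * rr + 3 with hb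
  set c : ℝ := 2 * rr ^ 2 - s4 + 3 * rr + 2 with hc
  have hbpos : 0 < b := by rw [hb]; linarith
  have hcpos : 0 < c := by rw [hc]; nlinarith
  have hdisc : 1 ≤ b ^ 2 - 4 * c := by rw [hb, hc]; nlinarith
  set s : ℝ := Real.sqrt (b ^ 2 - 4 * c) with hs
  have hs0 : 0 < s := Real.sqrt_pos.mpr (by linarith)
  have hssq : s ^ 2 = b ^ 2 - 4 * c := Real.sq_sqrt (by linarith)
  have hsb : s < b := by
    rw [hs, Real.sqrt_lt' hbpos]
    linarith
  set a₁ : ℝ := (b - s) / 2 with ha₁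
  set a₂ : ℝ := (b + s) / 2 with ha₂
  have ha₁pos : 0 < a₁ := by rw [ha₁]; linarith
  have ha₂pos : 0 < a₂ := by rw [ha₂]; linarith
  have ha₁₂ : a₁ < a₂ := by rw [ha₁, ha₂]; linarith
  have hsum : a₁ + a₂ = b := by rw [ha₁, ha₂]; ring
  have hprod : a₁ * a₂ = c := by
    rw [ha₁, ha₂]
    linear_combination (-1 / 4 : ℝ) * hssq
  -- the numerator's zero `u = -A` interlaces the shells
  set A : ℝ := rr + 3 / 2 with hA
  have hinter : (a₁ - A) * (a₂ - A) < 0 := by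
    have : (a₁ - A) * (a₂ - A) = A ^ 2 - b * A + c := by
      have : (a₁ - A) * (a₂ - A) = A ^ 2 - (a₁ + a₂) * A + a₁ * a₂ := by ring
      rw [this, hsum, hprod]
    rw [this, hA, hb, hc]
    nlinarith
  have hA₁ : a₁ ≤ A := by nlinarith
  have hA₂ : A ≤ a₂ := by nlinarith
  have hne : a₂ - a₁ ≠ 0 := sub_ne_zero.mpr (ne_of_gt ha₁₂)
  -- the package
  refine ⟨2, ![Real.sqrt a₁, Real.sqrt a₂], ![(A - a₁) / (a₂ - a₁), (a₂ - A) / (a₂ - a₁)], 0, ?_, ?_, ?_⟩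
  · intro j
    fin_cases j
    · exact Real.sqrt_pos.mpr ha₁pos
    · exact Real.sqrt_pos.mpr ha₂pos
  · intro j
    fin_cases j
    · exact div_nonneg (sub_nonneg.mpr hA₁) (sub_pos.mpr ha₁₂).le
    · exact div_nonneg (sub_nonneg.mpr hA₂) (sub_pos.mpr ha₁₂).le
  · intro t
    rw [eval_witnessN, eval_witnessD]
    simp only [Fin.sum_univ_succ (n := 3), Fin.cons_zero, Fin.cons_succ, Polynomial.eval_zero, zero_add,
      Fin.sum_univ_two, Matrix.cons_val_zero, Matrix.cons_val_one]
    rw [Real.sq_sqrt ha₁pos.le, Real.sq_sqrt ha₂pos.le, ← hrr, ← hs4]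
    have ht₁ : t ^ 2 + a₁ ≠ 0 := by positivity
    have ht₂ : t ^ 2 + a₂ ≠ 0 := by positivity
    have hD : 2 * (t ^ 2 + rr) ^ 2 - (t ^ 4 + s4) + 3 * (t ^ 2 + rr) + 2 = (t ^ 2 + a₁) * (t ^ 2 + a₂) := by
      have : (t ^ 2 + a₁) * (t ^ 2 + a₂) = t ^ 4 + (a₁ + a₂) * t ^ 2 + a₁ * a₂ := by ring
      rw [this, hsum, hprod, hb, hc]
      ring
    rw [hD, hA]
    field_simp
    ring

/-! ## The witness is not radial -/

/-- No polynomials `F, G` with `G ≠ 0` satisfy `N·G(p²) = D·F(p²)`: the axis and the diagonal at equal `p² = 4t²`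
see different `D`. [folklore] -/
theorem witness_not_radial :
    ¬ ∃ F G : Polynomial ℝ, G ≠ 0 ∧ ∀ p : Fin 4 → ℝ,
      MvPolynomial.eval p ((∑ i : Fin 4, X i ^ 2) + C (3 / 2 : ℝ) : MvPolynomial (Fin 4) ℝ) *
          G.eval (∑ i, p i ^ 2) =
        MvPolynomial.eval p
            (C (2 : ℝ) * (∑ i : Fin 4, X i ^ 2) ^ 2 - (∑ i : Fin 4, X i ^ 4) + C (3 : ℝ) * (∑ i : Fin 4, X i ^ 2) +
              C (2 : ℝ) : MvPolynomial (Fin 4) ℝ) *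
          F.eval (∑ i, p i ^ 2) := by
  rintro ⟨F, G, hG, h⟩
  -- axis and diagonal points
  have haxis : ∀ t : ℝ, (4 * t ^ 2 + 3 / 2) * G.eval (4 * t ^ 2) = (16 * t ^ 4 + 12 * t ^ 2 + 2) * F.eval (4 * t ^ 2) := by
    intro t
    have := h ![2 * t, 0, 0, 0]
    rw [eval_witnessN, eval_witnessD] at this
    simp only [Fin.sum_univ_four, Matrix.cons_val_zero, Matrix.cons_val_one, Matrix.head_cons,
      Matrix.cons_val_two, Matrix.tail_cons, Matrix.cons_val_three] at this
    have e1 : (2 * t) ^ 2 + 0 ^ 2 + 0 ^ 2 + 0 ^ 2 = 4 * t ^ 2 := by ring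
    rw [e1] at this
    linear_combination this
  have hdiag : ∀ t : ℝ, (4 * t ^ 2 + 3 / 2) * G.eval (4 * t ^ 2) = (28 * t ^ 4 + 12 * t ^ 2 + 2) * F.eval (4 * t ^ 2) := by
    intro t
    have := h ![t, t, t, t]
    rw [eval_witnessN, eval_witnessD] at this
    simp only [Fin.sum_univ_four, Matrix.cons_val_zero, Matrix.cons_val_one, Matrix.head_cons,
      Matrix.cons_val_two, Matrix.tail_cons, Matrix.cons_val_three] at this
    have e1 : t ^ 2 + t ^ 2 + t ^ 2 + t ^ 2 = 4 * t ^ 2 := by ring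
    rw [e1] at this
    linear_combination this
  -- `F` vanishes on `(0, ∞)`, hence `F = 0`
  have hF0 : ∀ x : ℝ, 0 < x → F.eval x = 0 := by
    intro x hx
    set t : ℝ := Real.sqrt x / 2 with ht
    have htx : 4 * t ^ 2 = x := by
      rw [ht, div_pow, Real.sq_sqrt hx.le]; ring
    have ht0 : t ≠ 0 := by
      rw [ht]; exact div_ne_zero (Real.sqrt_ne_zero'.mpr hx) two_ne_zero
    have h12 : 12 * t ^ 4 * F.eval (4 * t ^ 2) = 0 := by linarith [haxis t, hdiag t]
    have ht4 : 12 * t ^ 4 ≠ 0 := by positivity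
    rw [← htx]
    exact (mul_eq_zero.mp h12).resolve_left ht4
  have hF : F = 0 := by
    refine Polynomial.eq_zero_of_infinite_isRoot F (Set.Infinite.mono ?_ (Set.Ioi_infinite (0 : ℝ)))
    intro x hx
    exact hF0 x hx
  -- then `G` vanishes on `[0, ∞)`, hence `G = 0`
  have hG0 : ∀ x : ℝ, 0 < x → G.eval x = 0 := by
    intro x hx
    set t : ℝ := Real.sqrt x / 2 with ht
    have htx : 4 * t ^ 2 = x := by
      rw [ht, div_pow, Real.sq_sqrt hx.le]; ring
    have hax := haxis t
    rw [hF, Polynomial.eval_zero, mul_zero] at hax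
    have hpos : 4 * t ^ 2 + 3 / 2 ≠ 0 := by positivity
    rw [← htx]
    exact (mul_eq_zero.mp hax).resolve_left hpos
  apply hG
  refine Polynomial.eq_zero_of_infinite_isRoot G (Set.Infinite.mono ?_ (Set.Ioi_infinite (0 : ℝ)))
  intro x hx
  exact hG0 x hx

/-! ## The negative lemma -/

/-- **`RationalShortRootRigidity` is FALSE WITHOUT the `W(F₄)` reflection (h2).**  The statement below is the
body of `Summit.QuantumFields.YangMills.Theses.F4SubCurvatureDoor.RationalShortRootRigidity` (item
stmt-QuantumFields-23124) with its binders copied verbatim EXCEPT that the hypothesis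
`∀ p, eval (p − ½(Σpⱼ)·𝟙) N = eval p N ∧ eval (p − ½(Σpⱼ)·𝟙) D = eval p D` (invariance under the short-root
reflection) is deleted; the witness `N = Σpᵢ² + 3/2`, `D = 2(Σpᵢ²)² − Σpᵢ⁴ + 3Σpᵢ² + 2` satisfies all remaining
hypotheses (even the axis-Stieltjes one for every `q`, `q = 0` included) and is not radial.  So `W(B₄)` symmetry
plus axis reflection positivity plus the sub-curvature budget never force `O(4)`-radiality of a rational two-point
function: the half-integer short roots are load-bearing in the crux. [folklore] -/
theorem rationalShortRootRigidity_false_without_F4Reflection :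
    ¬ (∀ N D : MvPolynomial (Fin 4) ℝ, (∀ (σ : Equiv.Perm (Fin 4)) (ε : Fin 4 → ℝ), (∀ i, ε i = 1 ∨ ε i = -1) → ∀ p : Fin 4 → ℝ, MvPolynomial.eval (fun i => ε i * p (σ i)) N = MvPolynomial.eval p N ∧ MvPolynomial.eval (fun i => ε i * p (σ i)) D = MvPolynomial.eval p D) → MvPolynomial.coeff (Finsupp.single 0 D.totalDegree) D ≠ 0 → N.totalDegree ≤ D.totalDegree + 2 → (∀ q : Fin 3 → ℝ, q ≠ 0 → ∃ (k : ℕ) (ω r : Fin k → ℝ) (c : Polynomial ℝ), (∀ j, 0 < ω j) ∧ (∀ j, 0 ≤ r j) ∧ ∀ t : ℝ, MvPolynomial.eval (Fin.cons t q) N = MvPolynomial.eval (Fin.cons t q) D * (c.eval (t ^ 2) + ∑ j, r j / (t ^ 2 + ω j ^ 2))) → ∃ F G : Polynomial ℝ, G ≠ 0 ∧ ∀ p : Fin 4 → ℝ, MvPolynomial.eval p N * G.eval (∑ i, p i ^ 2) = MvPolynomial.eval p D * F.eval (∑ i, p i ^ 2)) := by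
  intro h
  apply witness_not_radial
  refine h ((∑ i : Fin 4, X i ^ 2) + C (3 / 2 : ℝ))
    (C (2 : ℝ) * (∑ i : Fin 4, X i ^ 2) ^ 2 - (∑ i : Fin 4, X i ^ 4) + C (3 : ℝ) * (∑ i : Fin 4, X i ^ 2) + C (2 : ℝ))
    ?_ ?_ ?_ ?_
  · -- (h1) signed-permutation invariance
    intro σ ε hε p
    rw [eval_witnessN, eval_witnessN, eval_witnessD, eval_witnessD]
    have h2 := sum_pow_signedPerm σ ε hε p 1
    have h4 := sum_pow_signedPerm σ ε hε p 2
    norm_num at h2 h4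
    rw [h2, h4]
    exact ⟨rfl, rfl⟩
  · -- (h3) full degree in `p₀`
    rw [totalDegree_witnessD, coeff_witnessD]
    exact one_ne_zero
  · -- (h4) the sub-curvature budget
    rw [totalDegree_witnessD]
    exact totalDegree_witnessN_le.trans (by norm_num)
  · -- (h5) axis-Stieltjes for every `q ≠ 0` (in fact for every `q`)
    intro q _
    exact witness_axisStieltjes q

end Summit.QuantumFields.YangMills.Theorems.RationalShortRootRigidity.Negative
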